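import Mathlib
import Summits.Ventures.PercRepro2.Defs
import Summits.Ventures.PercRepro2.Independence
import Summits.Ventures.PercRepro2.Harris
import Summits.Ventures.PercRepro2.Graph
import Summits.Ventures.PercRepro2.Exploration
import Summits.Ventures.PercRepro2.Events
import Summits.Ventures.PercRepro2.Induced
import Summits.Ventures.PercRepro2.BHK
import Summits.Ventures.PercRepro2.BHKEvents
import Summits.Ventures.PercRepro2.OneEdge
import Summits.Ventures.PercRepro2.RBRoot
import Summits.Ventures.PercRepro2.RBRootEdge
import Summits.Ventures.PercRepro2.RBRootEdgePin
import Summits.Ventures.PercRepro2.RBRootEdgeMain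
import Summits.Ventures.PercRepro2.RBRootIsolated
import Summits.Ventures.PercRepro2.RBTwoMarkers
import Summits.Ventures.PercRepro2.RBTwoMarkersMain
import Summits.Ventures.PercRepro2.RBTwoMarkersCross
import Summits.Ventures.PercRepro2.RBTwoMarkersCrossMain
import Summits.Ventures.PercRepro2.RBLeaf

/-!
# The series reduction, I: configuration transfer and the domain Markov step (mine-a g5; MINE-A.md §36)

An unmarked vertex `u` with exactly two edges `f₁ = {u, v₁}`, `f₂ = {u, v₂}` of nonzero weight is
suppressed: the configuration `ω* = ω[e₀ ↦ ω e₀ ∨ (ω f₁ ∧ ω f₂)][f₁ ↦ 0][f₂ ↦ 0]` (`e₀ = {v₁, v₂}` an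
edge of the graph, of any weight) has the same connections among vertices `≠ u` (`conn_series`),
and the cluster of `w ≠ u` gains `u` exactly when `(v₁ ∈ C* ∧ f₁) ∨ (v₂ ∈ C* ∧ f₂)`
(`cluster_series`). The domain Markov step for an edge inside the atom
(`prob_update_inter_clusterEvent_mul`): the row's events are conditionally independent of such an
edge given `{C(w) = A}` — the reason the reduction is exact (MINE-A.md §36).
-/

namespace Summit.Ventures.PercRepro2

namespace RBSeries

open scoped Classical

section Transfer

variable {V : Type*} {E : Type*} [DecidableEq E] (ends : E → Sym2 V) (u : V)

/-- The effective configuration of the series reduction. -/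
def eff (e₀ f₁ f₂ : E) (ω : Config E) : Config E :=
  Function.update (Function.update (Function.update ω e₀ (ω e₀ || (ω f₁ && ω f₂))) f₁ false) f₂ false

/-- With both series edges closed, `u` is isolated. -/
lemma closed_series {f₁ f₂ : E} {ω : Config E}
    (hcl : ∀ e, u ∈ ends e ∧ e ≠ f₁ ∧ e ≠ f₂ → ω e = false) :
    ∀ e, u ∈ ends e → Function.update (Function.update ω f₁ false) f₂ false e = false := by
  intro e he
  by_cases h2 : e = f₂
  · subst h2; exact Function.update_self _ _ _
  · rw [Function.update_of_ne h2]
    by_cases h1 : e = f₁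
    · subst h1; exact Function.update_self _ _ _
    · rw [Function.update_of_ne h1]; exact hcl e ⟨he, h1, h2⟩

/-- **Connections transfer, closed form**: for `ω₀` with every edge at `u` closed and any states
`y, z` of the series edges, `Conn ω₀[f₁ ↦ y][f₂ ↦ z] x x' ↔ Conn ω₀[e₀ ↦ ω₀ e₀ ∨ (y ∧ z)] x x'`
for `x, x' ≠ u`. -/
lemma conn_series_of_closed {e₀ f₁ f₂ : E} {v₁ v₂ : V} (hends₀ : ends e₀ = s(v₁, v₂))
    (hends₁ : ends f₁ = s(u, v₁)) (hends₂ : ends f₂ = s(u, v₂)) (hv₂ : v₂ ≠ u) (h12 : f₁ ≠ f₂)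
    {ω₀ : Config E} (hcl₀ : ∀ e, u ∈ ends e → ω₀ e = false) (y z : Bool) {x x' : V} (hx : x ≠ u)
    (hx' : x' ≠ u) :
    Conn ends (Function.update (Function.update ω₀ f₁ y) f₂ z) x x' ↔
      Conn ends (Function.update ω₀ e₀ (ω₀ e₀ || (y && z))) x x' := by
  have hf₁ : u ∈ ends f₁ := by rw [hends₁]; exact Sym2.mem_mk_left u v₁
  have hf₂ : u ∈ ends f₂ := by rw [hends₂]; exact Sym2.mem_mk_left u v₂
  have hcl₁ : ∀ e, u ∈ ends e ∧ e ≠ f₁ → ω₀ e = false := fun e he => hcl₀ e he.1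
  have hcl₂ : ∀ e, u ∈ ends e ∧ e ≠ f₂ → ω₀ e = false := fun e he => hcl₀ e he.1
  have hf₂' : ∀ c : Bool, (false : Bool) = Function.update ω₀ f₁ c f₂ := by
    intro c; rw [Function.update_of_ne h12.symm]; exact (hcl₀ f₂ hf₂).symm
  cases y <;> cases z
  · rw [Bool.false_and, Bool.or_false, Function.update_eq_self, Function.update_eq_self_iff.2 (hf₂' false),
      Function.update_eq_self_iff.2 (hcl₀ f₁ hf₁).symm]
  · have e1 : Function.update ω₀ f₁ false = ω₀ := Function.update_eq_self_iff.2 (hcl₀ f₁ hf₁).symm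
    rw [Bool.false_and, Bool.or_false, Function.update_eq_self, e1]
    exact RBTwoMarkers.conn_leaf_iff_of_closed ends u hends₂ hcl₂ hx hx' true
  · rw [Bool.true_and, Bool.or_false, Function.update_eq_self, Function.update_eq_self_iff.2 (hf₂' true)]
    exact RBTwoMarkers.conn_leaf_iff_of_closed ends u hends₁ hcl₁ hx hx' true
  · rw [Bool.true_and, Bool.or_true, RBTwoMarkers.conn_force_two ends u hends₁ hends₂ hv₂ hcl₀ hx hx',
      OneEdge.conn_update_true_iff hends₀]

/-- **Connections transfer**: for `x, y ≠ u`, `Conn ω x y ↔ Conn ω* x y` when every other edge at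
`u` is closed. -/
lemma conn_series {e₀ f₁ f₂ : E} {v₁ v₂ : V} (hends₀ : ends e₀ = s(v₁, v₂))
    (hends₁ : ends f₁ = s(u, v₁)) (hends₂ : ends f₂ = s(u, v₂)) (hv₂ : v₂ ≠ u)
    (h12 : f₁ ≠ f₂) (h01 : e₀ ≠ f₁) (h02 : e₀ ≠ f₂) {ω : Config E}
    (hcl : ∀ e, u ∈ ends e ∧ e ≠ f₁ ∧ e ≠ f₂ → ω e = false) {x y : V} (hx : x ≠ u) (hy : y ≠ u) :
    Conn ends ω x y ↔ Conn ends (eff e₀ f₁ f₂ ω) x y := by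
  have hcl₀ := closed_series ends u hcl
  have heff : eff e₀ f₁ f₂ ω = Function.update (Function.update (Function.update ω f₁ false) f₂ false)
      e₀ ((Function.update (Function.update ω f₁ false) f₂ false) e₀ || (ω f₁ && ω f₂)) := by
    unfold eff
    rw [Function.update_of_ne h02, Function.update_of_ne h01, Function.update_comm h01,
      Function.update_comm h02]
  have hω : ω = Function.update (Function.update (Function.update (Function.update ω f₁ false) f₂ false)
      f₁ (ω f₁)) f₂ (ω f₂) := by
    rw [Function.update_comm h12.symm]
    simp only [Function.update_idem, Function.update_eq_self]
  rw [heff]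
  conv_lhs => rw [hω]
  exact conn_series_of_closed ends u hends₀ hends₁ hends₂ hv₂ h12 hcl₀ (ω f₁) (ω f₂) hx hy

/-- **Clusters transfer**: for `w ≠ u`, `C_ω(w) = C_{ω*}(w)`, plus `u` exactly when
`(v₁ ∈ C_{ω*}(w) ∧ f₁) ∨ (v₂ ∈ C_{ω*}(w) ∧ f₂)`. -/
lemma cluster_series {e₀ f₁ f₂ : E} {v₁ v₂ : V} (hends₀ : ends e₀ = s(v₁, v₂))
    (hends₁ : ends f₁ = s(u, v₁)) (hends₂ : ends f₂ = s(u, v₂)) (hv₁ : v₁ ≠ u) (hv₂ : v₂ ≠ u)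
    (h12 : f₁ ≠ f₂) (h01 : e₀ ≠ f₁) (h02 : e₀ ≠ f₂) {ω : Config E}
    (hcl : ∀ e, u ∈ ends e ∧ e ≠ f₁ ∧ e ≠ f₂ → ω e = false) {w : V} (hwu : w ≠ u) :
    cluster ends ω w =
      if (v₁ ∈ cluster ends (eff e₀ f₁ f₂ ω) w ∧ ω f₁ = true) ∨
          (v₂ ∈ cluster ends (eff e₀ f₁ f₂ ω) w ∧ ω f₂ = true) then
        insert u (cluster ends (eff e₀ f₁ f₂ ω) w)
      else cluster ends (eff e₀ f₁ f₂ ω) w := by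
  have hu0 : u ∉ cluster ends (eff e₀ f₁ f₂ ω) w := by
    intro hu
    have hcl' : ∀ e, u ∈ ends e → eff e₀ f₁ f₂ ω e = false := by
      intro e he
      unfold eff
      by_cases h2 : e = f₂
      · subst h2; exact Function.update_self _ _ _
      · rw [Function.update_of_ne h2]
        by_cases h1 : e = f₁
        · subst h1; exact Function.update_self _ _ _
        · rw [Function.update_of_ne h1]
          have h0 : e ≠ e₀ := by
            rintro rfl
            rw [hends₀] at he
            rcases Sym2.mem_iff.1 he with h | h
            · exact hv₁ h.symm
            · exact hv₂ h.symm
          rw [Function.update_of_ne h0]; exact hcl e ⟨he, h1, h2⟩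
    have : w ∈ cluster ends (eff e₀ f₁ f₂ ω) u := conn_symm hu
    rw [RBTwoMarkers.cluster_eq_singleton_of_closed ends u hcl'] at this
    exact hwu this
  -- `w ↔ u` in `ω` iff `w` reaches `v₁` through an open `f₁` or `v₂` through an open `f₂`
  have key : Conn ends ω w u ↔ (Conn ends ω w v₁ ∧ ω f₁ = true) ∨ (Conn ends ω w v₂ ∧ ω f₂ = true) := by
    constructor
    · intro h
      -- the last step into `u` is an open edge at `u`: `f₁` or `f₂`
      have hu' : u ∈ cluster ends ω w := h
      by_contra hno
      have hcl' : ∀ e, u ∈ ends e → ω e = false := by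
        intro e he
        by_cases h1 : e = f₁
        · subst h1
          cases hf : ω e
          · rfl
          · exfalso
            apply hno
            left
            refine ⟨?_, hf⟩
            exact conn_trans h (conn_of_openAdj ⟨e, hf, hends₁⟩)
        · by_cases h2 : e = f₂
          · subst h2
            cases hf : ω e
            · rfl
            · exfalso
              apply hno
              right
              refine ⟨?_, hf⟩
              exact conn_trans h (conn_of_openAdj ⟨e, hf, hends₂⟩)
          · exact hcl e ⟨he, h1, h2⟩
      have : w ∈ cluster ends ω u := conn_symm hu'
      rw [RBTwoMarkers.cluster_eq_singleton_of_closed ends u hcl'] at this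
      exact hwu this
    · rintro (⟨h, hf⟩ | ⟨h, hf⟩)
      · exact conn_trans h (conn_symm (conn_of_openAdj ⟨f₁, hf, hends₁⟩))
      · exact conn_trans h (conn_symm (conn_of_openAdj ⟨f₂, hf, hends₂⟩))
  ext z
  by_cases hz : z = u
  · subst hz
    simp only [mem_cluster]
    rw [key, conn_series ends z hends₀ hends₁ hends₂ hv₂ h12 h01 h02 hcl hwu hv₁,
      conn_series ends z hends₀ hends₁ hends₂ hv₂ h12 h01 h02 hcl hwu hv₂]
    split_ifs with hc
    · simp only [Set.mem_insert_iff, true_or, iff_true]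
      exact hc
    · constructor
      · intro h; exact absurd h hc
      · intro h; exact absurd h hu0
  · simp only [mem_cluster]
    rw [conn_series ends u hends₀ hends₁ hends₂ hv₂ h12 h01 h02 hcl hwu hz]
    split_ifs
    · simp only [Set.mem_insert_iff, hz, false_or, mem_cluster]
    · rfl

end Transfer

section Markov

variable {V : Type*} {E : Type*} [Fintype E] [DecidableEq E] [Fintype V] {R : Type*} [Field R]
  (ends : E → Sym2 V) (w : V)

omit [Fintype E] [DecidableEq E] [Field R] in
/-- On the atom `{C(w) = A}` a connection event is decided by membership in `A` or by the edges
not touching `A`. -/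
lemma exists_outside_conn (A : Set V) (x y : V) :
    ∃ Z : Set (Config E), DependsOn (· ∈ Z) (touches ends A)ᶜ ∧
      clusterEvent ends w A ∩ connEvent ends x y = clusterEvent ends w A ∩ Z := by
  by_cases hx : x ∈ A
  · by_cases hy : y ∈ A
    · refine ⟨Set.univ, fun _ _ _ => rfl, ?_⟩
      ext ω
      simp only [Set.mem_inter_iff, mem_clusterEvent, mem_connEvent, Set.mem_univ, and_true]
      constructor
      · exact fun h => h.1
      · intro h
        refine ⟨h, ?_⟩
        rw [← h] at hx hy
        exact conn_trans (conn_symm hx) hy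
    · refine ⟨∅, fun _ _ _ => rfl, ?_⟩
      ext ω
      simp only [Set.mem_inter_iff, mem_clusterEvent, mem_connEvent, Set.mem_empty_iff_false,
        and_false, iff_false, not_and]
      intro h hxy
      apply hy
      rw [← h] at hx ⊢
      exact conn_trans hx hxy
  · refine ⟨{ω | Conn ends (restrict (touches ends A)ᶜ ω) x y},
      dependsOn_restrict (touches ends A)ᶜ fun ω' => Conn ends ω' x y, ?_⟩
    exact clusterEvent_inter_connEvent ends w A hx

omit [Fintype E] [DecidableEq E] [Field R] in
/-- The row's atom events `Q ∩ {C(w) = A} ∩ {x ↔ y}` are `{C(w) = A} ∩ Z` with `Z` outside `A`. -/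
lemma exists_outside_atom (A : Set V) (s t x y : V) :
    ∃ Z : Set (Config E), DependsOn (· ∈ Z) (touches ends A)ᶜ ∧
      (connEvent ends s t)ᶜ ∩ clusterEvent ends w A ∩ connEvent ends x y =
        clusterEvent ends w A ∩ Z := by
  obtain ⟨Z₁, hZ₁, e₁⟩ := exists_outside_conn ends w A s t
  obtain ⟨Z₂, hZ₂, e₂⟩ := exists_outside_conn ends w A x y
  refine ⟨Z₁ᶜ ∩ Z₂, ?_, ?_⟩
  · intro ω ω' h
    simp only [Set.mem_inter_iff, Set.mem_compl_iff]
    rw [dependsOn_mem_iff hZ₁ h, dependsOn_mem_iff hZ₂ h]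
  · ext ω
    have h1 : ω ∈ clusterEvent ends w A → (ω ∈ connEvent ends s t ↔ ω ∈ Z₁) := by
      intro hC
      have := Set.ext_iff.1 e₁ ω
      simp only [Set.mem_inter_iff, hC, true_and] at this
      exact this
    have h2 : ω ∈ clusterEvent ends w A → (ω ∈ connEvent ends x y ↔ ω ∈ Z₂) := by
      intro hC
      have := Set.ext_iff.1 e₂ ω
      simp only [Set.mem_inter_iff, hC, true_and] at this
      exact this
    simp only [Set.mem_inter_iff, Set.mem_compl_iff]
    constructor
    · rintro ⟨⟨hQ, hC⟩, hX⟩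
      exact ⟨hC, fun h => hQ ((h1 hC).2 h), (h2 hC).1 hX⟩
    · rintro ⟨hC, hQ, hX⟩
      exact ⟨⟨fun h => hQ ((h1 hC).1 h), hC⟩, (h2 hC).2 hX⟩

omit [Fintype E] [DecidableEq E] [Field R] in
/-- `Q ∩ {C(w) = A}` is `{C(w) = A} ∩ Z` with `Z` outside `A`. -/
lemma exists_outside_atom' (A : Set V) (s t : V) :
    ∃ Z : Set (Config E), DependsOn (· ∈ Z) (touches ends A)ᶜ ∧
      (connEvent ends s t)ᶜ ∩ clusterEvent ends w A = clusterEvent ends w A ∩ Z := by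
  obtain ⟨Z₁, hZ₁, e₁⟩ := exists_outside_conn ends w A s t
  refine ⟨Z₁ᶜ, fun ω ω' h => by simp only [Set.mem_compl_iff]; rw [dependsOn_mem_iff hZ₁ h], ?_⟩
  ext ω
  have h1 : ω ∈ clusterEvent ends w A → (ω ∈ connEvent ends s t ↔ ω ∈ Z₁) := by
    intro hC
    have := Set.ext_iff.1 e₁ ω
    simp only [Set.mem_inter_iff, hC, true_and] at this
    exact this
  simp only [Set.mem_inter_iff, Set.mem_compl_iff]
  constructor
  · rintro ⟨hQ, hC⟩; exact ⟨hC, fun h => hQ ((h1 hC).2 h)⟩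
  · rintro ⟨hC, hQ⟩; exact ⟨fun h => hQ ((h1 hC).1 h), hC⟩

/-- **The domain Markov step for an edge inside the atom**: for `e` touching `A`,
`P_{e↦1}(Q ∩ C_A ∩ X) · P_{e↦0}(Q ∩ C_A) = P_{e↦0}(Q ∩ C_A ∩ X) · P_{e↦1}(Q ∩ C_A)` — the row's
events are conditionally independent of `e` given the atom. -/
theorem prob_update_atom_mul (p : E → R) {e : E} {A : Set V} (he : e ∈ touches ends A)
    (s t x y : V) :
    prob (Function.update p e 1) ((connEvent ends s t)ᶜ ∩ clusterEvent ends w A ∩ connEvent ends x y) *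
        prob (Function.update p e 0) ((connEvent ends s t)ᶜ ∩ clusterEvent ends w A) =
      prob (Function.update p e 0) ((connEvent ends s t)ᶜ ∩ clusterEvent ends w A ∩ connEvent ends x y) *
        prob (Function.update p e 1) ((connEvent ends s t)ᶜ ∩ clusterEvent ends w A) := by
  obtain ⟨Z, hZ, eZ⟩ := exists_outside_atom ends w A s t x y
  obtain ⟨Z', hZ', eZ'⟩ := exists_outside_atom' ends w A s t
  rw [eZ, eZ', prob_clusterEvent_inter_eq_mul _ ends w A hZ disjoint_compl_right,
    prob_clusterEvent_inter_eq_mul _ ends w A hZ disjoint_compl_right,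
    prob_clusterEvent_inter_eq_mul _ ends w A hZ' disjoint_compl_right,
    prob_clusterEvent_inter_eq_mul _ ends w A hZ' disjoint_compl_right,
    RBRootEdge.prob_update_one_of_dependsOn p ends he hZ,
    RBRootEdge.prob_update_zero_of_dependsOn p ends he hZ,
    RBRootEdge.prob_update_one_of_dependsOn p ends he hZ',
    RBRootEdge.prob_update_zero_of_dependsOn p ends he hZ']
  ring

end Markov

section Law

variable {V : Type*} {E : Type*} [Fintype E] [DecidableEq E] {R : Type*} [Field R]

omit [Fintype E] [Field R] in
/-- The effective configuration of a forced pattern `(e₀, f₁, f₂) = (x, y, z)`. -/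
lemma eff_update {e₀ f₁ f₂ : E} (h12 : f₁ ≠ f₂) (h01 : e₀ ≠ f₁) (h02 : e₀ ≠ f₂) (ω : Config E)
    (x y z : Bool) :
    eff e₀ f₁ f₂ (Function.update (Function.update (Function.update ω e₀ x) f₁ y) f₂ z) =
      Function.update (Function.update (Function.update ω e₀ (x || (y && z))) f₁ false) f₂ false := by
  funext e
  simp only [eff, Function.update_apply]
  split_ifs <;> simp_all

/-- The law of a forced pattern `(e₀, f₁, f₂) = (x, y, z)`, read under `p`. -/
lemma prob_forced (p : E → R) (e₀ f₁ f₂ : E) (S : Set (Config E)) (x y z : Bool) :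
    prob (Function.update (Function.update (Function.update p e₀ (cond x 1 0)) f₁ (cond y 1 0)) f₂
        (cond z 1 0)) S =
      prob p {ω | Function.update (Function.update (Function.update ω e₀ x) f₁ y) f₂ z ∈ S} := by
  cases x <;> cases y <;> cases z <;> simp only [Bool.cond_true, Bool.cond_false] <;>
    (first
    | rw [RBRootEdge.prob_update_one_eq, RBRootEdge.prob_update_one_eq, RBRootEdge.prob_update_one_eq]
    | rw [RBRootEdge.prob_update_one_eq, RBRootEdge.prob_update_one_eq, RBRootEdge.prob_update_zero_eq]
    | rw [RBRootEdge.prob_update_one_eq, RBRootEdge.prob_update_zero_eq, RBRootEdge.prob_update_one_eq]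
    | rw [RBRootEdge.prob_update_one_eq, RBRootEdge.prob_update_zero_eq, RBRootEdge.prob_update_zero_eq]
    | rw [RBRootEdge.prob_update_zero_eq, RBRootEdge.prob_update_one_eq, RBRootEdge.prob_update_one_eq]
    | rw [RBRootEdge.prob_update_zero_eq, RBRootEdge.prob_update_one_eq, RBRootEdge.prob_update_zero_eq]
    | rw [RBRootEdge.prob_update_zero_eq, RBRootEdge.prob_update_zero_eq, RBRootEdge.prob_update_one_eq]
    | rw [RBRootEdge.prob_update_zero_eq, RBRootEdge.prob_update_zero_eq, RBRootEdge.prob_update_zero_eq])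
    <;> rfl

/-- The law of a forced pattern, read under `p` through the effective configuration. -/
lemma prob_pattern (p : E → R) {e₀ f₁ f₂ : E} (h12 : f₁ ≠ f₂) (h01 : e₀ ≠ f₁) (h02 : e₀ ≠ f₂)
    (S : Set (Config E)) (hS : ∀ ω : Config E, ω ∈ S ↔ eff e₀ f₁ f₂ ω ∈ S) (x y z : Bool) :
    prob (Function.update (Function.update (Function.update p e₀ (cond x 1 0)) f₁ (cond y 1 0)) f₂
        (cond z 1 0)) S =
      prob p {ω | Function.update (Function.update (Function.update ω e₀ (x || (y && z))) f₁ false)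
        f₂ false ∈ S} := by
  rw [prob_forced p e₀ f₁ f₂ S x y z]
  congr 1
  ext ω
  simp only [Set.mem_setOf_eq]
  rw [hS, eff_update h12 h01 h02]

/-- **The series law transfer**: for `S` blind to the series pattern except through its effective
configuration, `P_p(S) = P_{p*}(S)` with `p* = p[e₀ ↦ p e₀ + (1 − p e₀) p f₁ p f₂][f₁ ↦ 0][f₂ ↦ 0]`. -/
theorem prob_series_transfer (p : E → R) {e₀ f₁ f₂ : E} (h12 : f₁ ≠ f₂) (h01 : e₀ ≠ f₁)
    (h02 : e₀ ≠ f₂) (S : Set (Config E)) (hS : ∀ ω : Config E, ω ∈ S ↔ eff e₀ f₁ f₂ ω ∈ S) :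
    prob p S = prob (Function.update (Function.update (Function.update p e₀
      (p e₀ + (1 - p e₀) * (p f₁ * p f₂))) f₁ 0) f₂ 0) S := by
  have k := prob_pattern p h12 h01 h02 S hS
  have k111 := k true true true
  have k110 := k true true false
  have k101 := k true false true
  have k100 := k true false false
  have k011 := k false true true
  have k010 := k false true false
  have k001 := k false false true
  have k000 := k false false false
  clear k
  simp only [Bool.cond_true, Bool.cond_false, Bool.and_true, Bool.and_false, Bool.or_true,
    Bool.or_false] at *
  -- the eight pinned laws under `p`
  have c1 : ∀ c : R, Function.update (Function.update p e₀ c) f₁ 1 f₂ = p f₂ := by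
    intro c; rw [Function.update_of_ne h12.symm, Function.update_of_ne h02.symm]
  have c0 : ∀ c : R, Function.update (Function.update p e₀ c) f₁ 0 f₂ = p f₂ := by
    intro c; rw [Function.update_of_ne h12.symm, Function.update_of_ne h02.symm]
  have d : ∀ c : R, Function.update p e₀ c f₁ = p f₁ := fun c => Function.update_of_ne h01.symm _ _
  rw [prob_eq_pin p S e₀, prob_eq_pin (Function.update p e₀ 1) S f₁, prob_eq_pin (Function.update p e₀ 0) S f₁,
    d, d, prob_eq_pin (Function.update (Function.update p e₀ 1) f₁ 1) S f₂,
    prob_eq_pin (Function.update (Function.update p e₀ 1) f₁ 0) S f₂,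
    prob_eq_pin (Function.update (Function.update p e₀ 0) f₁ 1) S f₂,
    prob_eq_pin (Function.update (Function.update p e₀ 0) f₁ 0) S f₂, c1, c0, c1, c0,
    k111, k110, k101, k100, k011, k010, k001, k000]
  -- the merged law
  have hq : Function.update (Function.update (Function.update p e₀ (p e₀ + (1 - p e₀) * (p f₁ * p f₂)))
      f₁ 0) f₂ 0 e₀ = p e₀ + (1 - p e₀) * (p f₁ * p f₂) := by
    rw [Function.update_of_ne h02, Function.update_of_ne h01, Function.update_self]
  have hq1 : Function.update (Function.update (Function.update (Function.update p e₀
      (p e₀ + (1 - p e₀) * (p f₁ * p f₂))) f₁ 0) f₂ 0) e₀ 1 =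
      Function.update (Function.update (Function.update p e₀ 1) f₁ 0) f₂ 0 := by
    rw [Function.update_comm h02.symm, Function.update_comm h01.symm, Function.update_idem]
  have hq0 : Function.update (Function.update (Function.update (Function.update p e₀
      (p e₀ + (1 - p e₀) * (p f₁ * p f₂))) f₁ 0) f₂ 0) e₀ 0 =
      Function.update (Function.update (Function.update p e₀ 0) f₁ 0) f₂ 0 := by
    rw [Function.update_comm h02.symm, Function.update_comm h01.symm, Function.update_idem]
  rw [prob_eq_pin _ S e₀, hq, hq1, hq0, k100, k000]
  ring

end Law

end RBSeries

end Summit.Ventures.PercRepro2
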